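import Literature.Computability.AlgebraicComplexity.FlipGraphSymmetry
import HarnessLib

/-!
# Sandwich symmetries of the rectangular matrix multiplication tensor `⟨k,m,n⟩`
# (de Groote 1978, §3; Kauers–Moosbauer 2023, §2)

Topic `Literature/Computability/AlgebraicComplexity`. The tree's `actTensor_sandwich_matMulTensor`
(`MatMulLieIsotropy.lean`) and `FlipGraph.Symmetry.sandwich` (`FlipGraphSymmetry.lean`) are stated
for the square format `⟨n,n,n⟩`. The printed statement is for every format: "if `U ∈ K^{m×m}` is
invertible, then the identity `AB = AUU⁻¹B` implies that also replacing every rank-one tensor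
`A⊗B⊗Γ` by `AU⊗U⁻¹B⊗Γ` maps a correct scheme to another one. These transformations generate the
symmetry group of `M_{n,m,p}`" (Kauers–Moosbauer, ISSAC 2023, §2, citing de Groote 1978), and
with the outer factors (Moosbauer–Poole 2025, §2: "`(U,V,W)·A⊗B⊗C = UAV⁻¹ ⊗ VBW⁻¹ ⊗ WCU⁻¹`").
This file records the rectangular version, proofs verbatim those of the square case:

* `matMulTensor_eq_sum_standard_rect` — `⟨k,m,n⟩ = ∑_{κ,μ,ν} e_{κν} ⊗ e_{κμ} ⊗ e_{μν}` (the
  standard algorithm as an identity of tensors; the square case is `matMulTensor_eq_sum_standard`).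
* `actTensor_matMulTensor_apply_rect` — the triple matrix action on `⟨k,m,n⟩` in coordinates.
* `actTensor_sandwich_matMulTensor_rect` — for invertible `P ∈ GL_k`, `Q ∈ GL_m`, `R ∈ GL_n` the
  triple `(P⁻ᵀ ⊗ₖ R⁻ᵀ, P ⊗ₖ Q, Q⁻ᵀ ⊗ₖ R)` on the slots `(Z, X, Y)` (i.e. `X ↦ P X Qᵀ`,
  `Y ↦ Q⁻ᵀ Y Rᵀ`, `Z ↦ P⁻ᵀ Z R⁻¹` on coordinate vectors) fixes `⟨k,m,n⟩`.
* `FlipGraph.Symmetry.sandwichRect` — the corresponding `Symmetry (matMulTensor K k m n)` (so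
  `Scheme.map` / `Scheme.rank_map` / orbits of `FlipGraphSymmetry.lean` apply to every format).
* `sum_triad_sandwich_rect` — a decomposition `⟨k,m,n⟩ = ∑_ρ w_ρ ⊗ u_ρ ⊗ v_ρ` is carried to the
  decomposition `∑_ρ (P⁻ᵀ⊗R⁻ᵀ)w_ρ ⊗ (P⊗Q)u_ρ ⊗ (Q⁻ᵀ⊗R)v_ρ` of the same length (KM §2 "maps a
  correct scheme to another one").

Everything is PROVED; no named facts. Not here: that these maps (with transposition / cyclic
shifts where the format allows) GENERATE the isotropy group (de Groote 1978, Thm. 3.3/3.4) —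
not needed by the users (who need only that they ARE symmetries), and not formalised in the square
file either.

## References

* [Degroote1978] H. F. de Groote, *On varieties of optimal algorithms for the computation of
  bilinear mappings I. The isotropy group of a bilinear mapping*, Theoret. Comput. Sci. 7 (1978)
  1–24, §3.
* [KauersMoosbauer2022FlipGraphs] M. Kauers, J. Moosbauer, *Flip graphs for matrix
  multiplication*, ISSAC 2023 (arXiv:2212.01175), §2 (the symmetry group of `M_{n,m,p}`).
-/

namespace Literature.Computability.AlgebraicComplexity

open scoped Kronecker
open Matrix

/-! ## The standard algorithm and the triple action on `⟨k,m,n⟩` -/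

/-- **The standard algorithm as a tensor identity, rectangular format**:
`⟨k,m,n⟩ = ∑_{κ,μ,ν} e_{κν} ⊗ e_{κμ} ⊗ e_{μν}` (Bläser 2013, §5; the square case is
`matMulTensor_eq_sum_standard`). [cite: Blaser2013, §5] -/
theorem matMulTensor_eq_sum_standard_rect (R : Type*) [CommSemiring R] (k m n : ℕ) :
    matMulTensor R k m n = ∑ p : Fin k × Fin m × Fin n,
      triad (Pi.single (p.1, p.2.2) (1 : R)) (Pi.single (p.1, p.2.1) 1)
        (Pi.single (p.2.1, p.2.2) 1) := by
  classical
  funext a b c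
  rw [Finset.sum_apply, Finset.sum_apply, Finset.sum_apply]
  simp only [triad_apply]
  obtain ⟨a₁, a₂⟩ := a
  obtain ⟨b₁, b₂⟩ := b
  obtain ⟨c₁, c₂⟩ := c
  rw [Fintype.sum_eq_single (b₁, b₂, a₂)]
  · by_cases h₁ : a₁ = b₁ <;> by_cases h₂ : b₂ = c₁ <;> by_cases h₃ : a₂ = c₂ <;>
      simp [matMulTensor, Prod.ext_iff, h₁, h₂, h₃, eq_comm]
  · rintro ⟨κ', μ', ν'⟩ hne
    simp only [ne_eq, Prod.mk.injEq, not_and] at hne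
    by_cases h₁ : κ' = b₁
    · subst h₁
      by_cases h₂ : μ' = b₂
      · subst h₂
        have h₃ : ν' ≠ a₂ := hne rfl rfl
        simp [Pi.single_apply, Prod.ext_iff, Ne.symm h₃]
      · simp [Pi.single_apply, Prod.ext_iff, Ne.symm h₂]
    · simp [Pi.single_apply, Prod.ext_iff, Ne.symm h₁]

/-- **The triple action on `⟨k,m,n⟩` in coordinates**:
`((A ⊗ B ⊗ C)·⟨k,m,n⟩)(a,b,c) = Σ_{κ,μ,ν} A_{a,(κ,ν)} B_{b,(κ,μ)} C_{c,(μ,ν)}` — the image of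
`⟨k,m,n⟩ = ∑ e_{κν} ⊗ e_{κμ} ⊗ e_{μν}` under `A ⊗ B ⊗ C` (Bläser 2013, §5 and Lemma 5.4; square
case: `actTensor_matMulTensor_apply`). [cite: Blaser2013, §5 (the tensor ⟨k,m,n⟩) and Lemma 5.4] -/
theorem actTensor_matMulTensor_apply_rect {R : Type*} [CommRing R] {k m n : ℕ}
    (A : Matrix (Fin k × Fin n) (Fin k × Fin n) R) (B : Matrix (Fin k × Fin m) (Fin k × Fin m) R)
    (C : Matrix (Fin m × Fin n) (Fin m × Fin n) R) (a : Fin k × Fin n) (b : Fin k × Fin m)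
    (c : Fin m × Fin n) :
    actTensor A B C (matMulTensor R k m n) a b c =
      ∑ κ : Fin k, ∑ μ : Fin m, ∑ ν : Fin n, A a (κ, ν) * B b (κ, μ) * C c (μ, ν) := by
  rw [matMulTensor_eq_sum_standard_rect, actTensor_finset_sum_tensor, Finset.sum_apply,
    Finset.sum_apply, Finset.sum_apply, Fintype.sum_prod_type]
  refine Finset.sum_congr rfl fun κ _ => ?_
  rw [Fintype.sum_prod_type]
  refine Finset.sum_congr rfl fun μ _ => Finset.sum_congr rfl fun ν _ => ?_
  rw [actTensor_triad, triad_apply, Matrix.mulVec_single_one, Matrix.mulVec_single_one,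
    Matrix.mulVec_single_one]
  rfl

/-! ## The sandwich symmetries of `⟨k,m,n⟩` -/

section Sandwich

variable {K : Type*} [Field K] {k m n : ℕ}

/-- **Sandwich symmetries of `⟨k,m,n⟩`** (de Groote 1978, I, §3; KM 2023 §2 for `M_{n,m,p}`): for
invertible `P ∈ K^{k×k}`, `Q ∈ K^{m×m}`, `R ∈ K^{n×n}` the triple `(P⁻ᵀ ⊗ₖ R⁻ᵀ, P ⊗ₖ Q, Q⁻ᵀ ⊗ₖ R)`
on the slots `(Z, X, Y)` fixes the matrix multiplication tensor `⟨k,m,n⟩`. In coordinates the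
three index sums factor as `(P P⁻¹)_{b₁a₁} (Q Q⁻¹)_{b₂c₁} (R R⁻¹)_{c₂a₂}` (square case:
`actTensor_sandwich_matMulTensor`). [cite: Degroote1978, §3] -/
theorem actTensor_sandwich_matMulTensor_rect (P : Matrix (Fin k) (Fin k) K)
    (Q : Matrix (Fin m) (Fin m) K) (R : Matrix (Fin n) (Fin n) K) (hP : IsUnit P.det)
    (hQ : IsUnit Q.det) (hR : IsUnit R.det) :
    actTensor (P⁻¹ᵀ ⊗ₖ R⁻¹ᵀ) (P ⊗ₖ Q) (Q⁻¹ᵀ ⊗ₖ R) (matMulTensor K k m n) =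
      matMulTensor K k m n := by
  funext a b c
  rw [actTensor_matMulTensor_apply_rect]
  have hsummand : ∀ (κ : Fin k) (μ : Fin m) (ν : Fin n),
      (P⁻¹ᵀ ⊗ₖ R⁻¹ᵀ) a (κ, ν) * (P ⊗ₖ Q) b (κ, μ) * (Q⁻¹ᵀ ⊗ₖ R) c (μ, ν) =
      (P b.1 κ * P⁻¹ κ a.1) * ((Q b.2 μ * Q⁻¹ μ c.1) * (R c.2 ν * R⁻¹ ν a.2)) := by
    intro κ μ ν
    obtain ⟨a₁, a₂⟩ := a
    obtain ⟨b₁, b₂⟩ := b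
    obtain ⟨c₁, c₂⟩ := c
    simp only [kronecker_apply, transpose_apply]
    ring
  simp_rw [hsummand, ← Finset.mul_sum, ← Finset.sum_mul]
  rw [← Matrix.mul_apply, ← Matrix.mul_apply, ← Matrix.mul_apply, Matrix.mul_nonsing_inv _ hP,
    Matrix.mul_nonsing_inv _ hQ, Matrix.mul_nonsing_inv _ hR]
  obtain ⟨a₁, a₂⟩ := a
  obtain ⟨b₁, b₂⟩ := b
  obtain ⟨c₁, c₂⟩ := c
  simp only [matMulTensor, Matrix.one_apply]
  by_cases h₁ : a₁ = b₁ <;> by_cases h₂ : b₂ = c₁ <;> by_cases h₃ : a₂ = c₂ <;>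
    simp [h₁, h₂, h₃, eq_comm]

/-- **The sandwich symmetry of `⟨k,m,n⟩` as a `FlipGraph.Symmetry`** (so that `Scheme.map`,
`Scheme.rank_map`, orbits and invariance of `FlipGraphSymmetry.lean` apply to every format):
`X ↦ PXQᵀ`, `Y ↦ Q⁻ᵀYRᵀ`, `Z ↦ P⁻ᵀZR⁻¹` for invertible `P, Q, R` (square case:
`FlipGraph.Symmetry.sandwich`). [cite: KauersMoosbauer2022FlipGraphs, §2 (symmetry group)] -/
noncomputable def FlipGraph.Symmetry.sandwichRect (P : Matrix (Fin k) (Fin k) K)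
    (Q : Matrix (Fin m) (Fin m) K) (R : Matrix (Fin n) (Fin n) K) (hP : IsUnit P.det)
    (hQ : IsUnit Q.det) (hR : IsUnit R.det) : FlipGraph.Symmetry (matMulTensor K k m n) :=
  FlipGraph.Symmetry.ofAct (P⁻¹ᵀ ⊗ₖ R⁻¹ᵀ) (Pᵀ ⊗ₖ Rᵀ) (P ⊗ₖ Q) (P⁻¹ ⊗ₖ Q⁻¹) (Q⁻¹ᵀ ⊗ₖ R)
    (Qᵀ ⊗ₖ R⁻¹)
    (by rw [← mul_kronecker_mul, ← transpose_mul, ← transpose_mul, mul_nonsing_inv _ hP,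
      mul_nonsing_inv _ hR, transpose_one, transpose_one, one_kronecker_one])
    (by rw [← mul_kronecker_mul, ← transpose_mul, ← transpose_mul, nonsing_inv_mul _ hP,
      nonsing_inv_mul _ hR, transpose_one, transpose_one, one_kronecker_one])
    (by rw [← mul_kronecker_mul, mul_nonsing_inv _ hP, mul_nonsing_inv _ hQ, one_kronecker_one])
    (by rw [← mul_kronecker_mul, nonsing_inv_mul _ hP, nonsing_inv_mul _ hQ, one_kronecker_one])
    (by rw [← mul_kronecker_mul, ← transpose_mul, mul_nonsing_inv _ hQ, mul_nonsing_inv _ hR,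
      transpose_one, one_kronecker_one])
    (by rw [← mul_kronecker_mul, ← transpose_mul, nonsing_inv_mul _ hQ, nonsing_inv_mul _ hR,
      transpose_one, one_kronecker_one])
    (actTensor_sandwich_matMulTensor_rect P Q R hP hQ hR)

/-- **Sandwiching a scheme gives a scheme of the same length** (KM §2: "replacing every rank-one
tensor `A⊗B⊗Γ` by `AU⊗U⁻¹B⊗Γ` maps a correct scheme to another one"), rectangular format, on
explicit decompositions: from `⟨k,m,n⟩ = ∑_ρ w_ρ ⊗ u_ρ ⊗ v_ρ` one gets
`⟨k,m,n⟩ = ∑_ρ (P⁻ᵀ ⊗ₖ R⁻ᵀ)w_ρ ⊗ (P ⊗ₖ Q)u_ρ ⊗ (Q⁻ᵀ ⊗ₖ R)v_ρ`.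
[cite: KauersMoosbauer2022FlipGraphs, §2 (symmetry group)] -/
theorem sum_triad_sandwich_rect {σ : Type*} [Fintype σ] (P : Matrix (Fin k) (Fin k) K)
    (Q : Matrix (Fin m) (Fin m) K) (R : Matrix (Fin n) (Fin n) K) (hP : IsUnit P.det)
    (hQ : IsUnit Q.det) (hR : IsUnit R.det) {w : σ → Fin k × Fin n → K}
    {u : σ → Fin k × Fin m → K} {v : σ → Fin m × Fin n → K}
    (ht : matMulTensor K k m n = ∑ ρ, triad (w ρ) (u ρ) (v ρ)) :
    matMulTensor K k m n = ∑ ρ, triad ((P⁻¹ᵀ ⊗ₖ R⁻¹ᵀ) *ᵥ w ρ) ((P ⊗ₖ Q) *ᵥ u ρ)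
      ((Q⁻¹ᵀ ⊗ₖ R) *ᵥ v ρ) := by
  conv_lhs => rw [← actTensor_sandwich_matMulTensor_rect P Q R hP hQ hR, ht]
  rw [actTensor_finset_sum_tensor]
  exact Finset.sum_congr rfl fun ρ _ => actTensor_triad _ _ _ (w ρ) (u ρ) (v ρ)

/-- In particular the `X`-slot factors of a scheme can be moved by any `(P, Q) ∈ GL_k × GL_m`
(`u ↦ (P ⊗ₖ Q) u`, i.e. `U ↦ P U Qᵀ` on `k × m` matrices) at no cost in length: the rank of
`⟨k,m,n⟩` is attained by a decomposition containing `(P ⊗ₖ Q) u_{ρ₀}` as an `X`-factor whenever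
it is attained by one containing `u_{ρ₀}`. [cite: KauersMoosbauer2022FlipGraphs, §2 (symmetry group)] -/
theorem exists_sum_triad_sandwich_snd {σ : Type*} [Fintype σ] (P : Matrix (Fin k) (Fin k) K)
    (Q : Matrix (Fin m) (Fin m) K) (hP : IsUnit P.det) (hQ : IsUnit Q.det)
    {w : σ → Fin k × Fin n → K} {u : σ → Fin k × Fin m → K} {v : σ → Fin m × Fin n → K}
    (ht : matMulTensor K k m n = ∑ ρ, triad (w ρ) (u ρ) (v ρ)) :
    ∃ (w' : σ → Fin k × Fin n → K) (v' : σ → Fin m × Fin n → K),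
      matMulTensor K k m n = ∑ ρ, triad (w' ρ) ((P ⊗ₖ Q) *ᵥ u ρ) (v' ρ) :=
  ⟨_, _, sum_triad_sandwich_rect P Q (1 : Matrix (Fin n) (Fin n) K) hP hQ
    (by rw [det_one]; exact isUnit_one) ht⟩

end Sandwich

end Literature.Computability.AlgebraicComplexity
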